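/-
Origin: expansion seat `planner-pub-hodgecm-prl1-g11-0`, handover #3 2026-08-18T18:51Z md5 a50f9225fc5b002cbe78951dec4c1528 (E2′ wiring over the carver's file; NEW additive KERNEL leaf, 114 l.; imports HodgeCM.Model.ThetaModelExists (model1 v3 22dc4341e4fe, RUN-32 intake) + HodgeCM.Model.EndStatePerLAxioms (#1) — install AFTER BOTH (model1-g2 19:02:24Z (b): keep as separate sibling, no v4 fold); tested by inlining both imports (work/WiringTest.lean): rc 0, 0 war (`HOME/pub-hodgecm-prl1-g11/lean/ThetaModelExistsPerLAxioms.lean`, md5 a50f9225, 114 lines);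
landed by the packager successor (mc-unitary-1-g3, gen-8 kit) in gate run 32 as `HodgeCM/Model/ThetaModelExistsPerLAxioms.lean` (verbatim).
-/
/-
Origin: KEPT seat "PerL residual", session `planner-pub-hodgecm-prl1-g11-0` (unit pub-hodgecm-prl1-g11), 2026-08-18.
STAGED as `HOME/pub-hodgecm-prl1-g11/lean/ThetaModelExistsPerLAxioms.lean`; intended `HodgeCM/Model/ThetaModelExistsPerLAxioms.lean`,
installable only AFTER both imports are installed (model1 `HodgeCM/Model/ThetaModelExists.lean` v3 md5 22dc4341e4fe, and
`HodgeCM/Model/EndStatePerLAxioms.lean` md5 5e4b37d80c3c).  ADDITIVE LEAF, kernel only, no hypothesis introduced.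
-/
import Summits.HodgeConjecture.HodgeCM.Model.ThetaModelExists
import Summits.HodgeConjecture.HodgeCM.Model.EndStatePerLAxioms_2

/-!
# The `ThetaModelExists` consequences over the five model facts (`ModelAxiomsPerL`)

E2′ forms (binder `M : U.ModelAxiomsPerL` instead of `U.ModelAxioms`; everything else verbatim) of the theorems of
`HodgeCM.Model.ThetaModelExists` that carry `M`: the pointwise constructions `nonempty_thetaRealisation_at(_allChars)`,
`realisationExistsPerL_of_on`, and the §7 consequences `realisationExists_of_thetaModelExists`, `perL_of_thetaModelExists`,
`realisationExistsPerL_of_thetaModelExists_sextic`, `perL_of_thetaModelExists_sextic`, `perL_of_thetaModelExistsOn` — each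
primed.  The pointwise construction is `ModelAxiomsPerL.nonempty_thetaRealisation_at` (which takes the two PRINT facts only at
the levels of the given `V`; here they are fed from the global `Fact_embCover` / `Fact_innerEmb`).  `hcCM_of_thetaModelExists`
has no E2′ form (COR-CM consumes 21 of the 28 facts).
-/

noncomputable section

namespace HodgeCM

open Literature.AlgebraicGeometry.Motives (CMType)

namespace Universe

namespace ThetaModel

variable {U : Universe} (T : U.ThetaModel)

/-- E2′ form of `nonempty_thetaRealisation_at`: the theta realisation at ONE context from the five model facts, the two
PRINT facts, `Fact_hodgeRiemann20` and the six OPEN input bodies at that context. -/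
theorem nonempty_thetaRealisation_at' (M : U.ModelAxiomsPerL) (h₁ : T.Fact_embCover) (h₂ : T.Fact_innerEmb)
    (hHR : U.Fact_hodgeRiemann20) {L : CMField} {ι₁ : L →+* ℂ} (V : HermSpace3 L ι₁) (c : SeesawCtx L)
    (h₅ : T.ThetaSubAt V c) (h₆ : T.ThetaWedgeAt V c) (h₇ : T.ThetaGen12At V c)
    (h₈ : T.ThetaReal34At V c) (h₉ : T.CharsAt V c) (h₁₀ : T.OccAt V c) :
    Nonempty (U.ThetaRealisation ι₁ V c.K c.Ψ c.σ) :=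
  ModelAxiomsPerL.nonempty_thetaRealisation_at M T hHR V c (fun Γ Γ' h η => h₁ Γ Γ' h η) (fun Γ => h₂ Γ)
    h₅ h₆ h₇ h₈ h₉ h₁₀

/-- E2′ form of `nonempty_thetaRealisation_at_allChars`. -/
theorem nonempty_thetaRealisation_at_allChars' (M : U.ModelAxiomsPerL) (h₁ : T.Fact_embCover)
    (h₂ : T.Fact_innerEmb) (hHR : U.Fact_hodgeRiemann20) {L : CMField} {ι₁ : L →+* ℂ} (V : HermSpace3 L ι₁)
    (c : SeesawCtx L) (h₅ : T.ThetaSubAt V c) (h₆ : T.ThetaWedgeAt V c)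
    (h₇ : T.ThetaGen12AllAt V c) (h₈ : T.ThetaReal34AllAt V c) (h₉ : T.CharsAt V c) (h₁₀ : T.OccAt V c) :
    Nonempty (U.ThetaRealisation ι₁ V c.K c.Ψ c.σ) :=
  ModelAxiomsPerL.nonempty_thetaRealisation_at_allChars M T hHR V c (fun Γ Γ' h η => h₁ Γ Γ' h η)
    (fun Γ => h₂ Γ) h₅ h₆ h₇ h₈ h₉ h₁₀

/-- E2′ form of `realisationExistsPerL_of_on` (same proof text). -/
theorem realisationExistsPerL_of_on' (M : U.ModelAxiomsPerL) {S : ∀ {L : CMField}, SeesawCtx L → Prop}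
    (hS : ∀ {L : CMField} (c : SeesawCtx L), Module.finrank ℚ c.K = 6 → S c)
    (A : T.AllCharsNonDesignOn S)
    (hch : ∀ {L : CMField} {ι₁ : L →+* ℂ} (V : HermSpace3 L ι₁) (c : SeesawCtx L), T.GoodCtx ι₁ c → S c →
      T.CharsAt V c)
    (hκ : T.Design_kappaConj) (hs : T.Design_frameSignConj) (hHR : U.Fact_hodgeRiemann20) :
    U.RealisationExistsPerL := by
  intro K L j _ hK _ φ hφ ι₁ hι₁ t ht V
  have hmem : ∀ i, φ 0 ∈ (t i).1 := fun i => (ht i 0).mpr (by fin_cases i <;> rfl)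
  have hΨ : PairSum t := StubTree.pairSum_of_isPerLTypes K φ hφ hK t ht
  obtain ⟨D, hD⟩ := T.exists_seesawDatum_constructed hκ hs j ι₁ t hΨ
  let c : SeesawCtx L := ⟨K, t, φ 0, D⟩
  have hc : T.GoodCtx ι₁ c := ⟨hΨ, StubTree.injective_of_isPerLTypes K φ hφ t ht, hmem, ⟨j, hι₁, hD⟩⟩
  have hSc : S c := hS c hK
  exact T.nonempty_thetaRealisation_at_allChars' M A.embCover A.innerEmb hHR V c (A.thetaSub V c hc hSc)
    (A.thetaWedge V c hc hSc) (A.thetaGen12All V c hc hSc) (A.thetaReal34All V c hc hSc) (hch V c hc hSc)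
    (A.occ V c hc hSc)

end ThetaModel

variable (U : Universe)

/-- E2′ form: both realisation inputs from `ThetaModelExists` (`Assembly.realisationExists_ofSignRecipe₇'`). -/
theorem realisationExists_of_thetaModelExists' (M : U.ModelAxiomsPerL) (hHR : U.Fact_hodgeRiemann20)
    (H : U.ThetaModelExists) : U.RealisationExistsPerL ∧ U.RealisationExistsFace := by
  obtain ⟨h, C, w12, w34, A⟩ := H
  exact Assembly.realisationExists_ofSignRecipe₇' U M h C (fun c => (w12 c).side) (fun c => (w34 c).side) A hHR

/-- E2′ form: **`W_per^L` from `ThetaModelExists` and the five model facts** (`Assembly.perL_ofSignRecipe₇'`). -/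
theorem perL_of_thetaModelExists' (M : U.ModelAxiomsPerL) (hHR : U.Fact_hodgeRiemann20)
    (H : U.ThetaModelExists) : U.PerL := by
  obtain ⟨h, C, w12, w34, A⟩ := H
  exact Assembly.perL_ofSignRecipe₇' U M h C (fun c => (w12 c).side) (fun c => (w34 c).side) A hHR

/-- E2′ form: `RealisationExistsPerL` from the SEXTIC-restricted hypothesis and the five model facts. -/
theorem realisationExistsPerL_of_thetaModelExists_sextic' (M : U.ModelAxiomsPerL) (hHR : U.Fact_hodgeRiemann20)
    (H : U.ThetaModelExists_sextic) : U.RealisationExistsPerL := by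
  obtain ⟨h, C, w12, w34, A⟩ := H
  exact (C.thetaModelArch h w12 w34).realisationExistsPerL_of_on' M (fun _ hK => hK) A
    (fun V c hc _ => C.thetaModelArch_chars h w12 w34 V c hc)
    (C.design_kappaConj h _ _) (C.design_frameSignConj h _ _) hHR

/-- E2′ form: **`W_per^L` from the SEXTIC-restricted hypothesis and the five model facts** — the theorem node E
of the model-construction DAG instantiates (`U`, `M₅ : U.ModelAxiomsPerL`, `hHR`, `H` all constructed / proved). -/
theorem perL_of_thetaModelExists_sextic' (M : U.ModelAxiomsPerL) (hHR : U.Fact_hodgeRiemann20)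
    (H : U.ThetaModelExists_sextic) : U.PerL :=
  ModelAxiomsPerL.perL M (U.realisationExistsPerL_of_thetaModelExists_sextic' M hHR H)

/-- E2′ form: `W_per^L` from the hypothesis restricted to any class containing the sextic contexts. -/
theorem perL_of_thetaModelExistsOn' (M : U.ModelAxiomsPerL) (hHR : U.Fact_hodgeRiemann20)
    {S : ∀ {L : CMField}, SeesawCtx L → Prop}
    (hS : ∀ {L : CMField} (c : SeesawCtx L), Module.finrank ℚ c.K = 6 → S c) (H : U.ThetaModelExistsOn S) :
    U.PerL := by
  obtain ⟨h, C, w12, w34, A⟩ := H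
  exact U.perL_of_thetaModelExists_sextic' M hHR ⟨h, C, w12, w34, A.mono fun c hK => hS c hK⟩

end Universe

end HodgeCM

end
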